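import Summits.ResolutionOfSingularities.ResolutionOfSingularities.Theorems.FrobeniusLadderFRationalResolutionConeChartBlowupPoints
import Summits.ResolutionOfSingularities.ResolutionOfSingularities.Theorems.FrobeniusLadderFRationalResolutionFixedStratumNextRound
import HarnessLib

/-!
# Crux `FrobeniusLadder.FRationalResolution` (stmt-ResolutionOfSingularities-15317), line `redirect`,
# stub `stub_diagonalizableQuotientResolution` — **the points of the blow-up of a cone chart algebra along the chain,
# over a point of a log stratum of ANY dimension: regular, or the image of a fixed prime with parameter `c ≥ 2`**
# (design C3 = the rank-2 stratum layer of the non-isolated case, memo MEMO-15317-leafhand2-g10 §2 (L2): lineage 2's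
# `…ConeChartBlowupPoints.stalk_regular_or_fixedPrime` VERBATIM with the zero-dimensional-stratum hypotheses `h0`
# (`𝔪_{A_𝔭} = I(𝔭)A_𝔭`) and `hdimA` (`dim A_𝔭 ≤ 2`) REPLACED by log regularity along the stratum of `𝔭` and the rank
# bound `n − rk F_𝔭 ≤ 2`, through `…FixedStratumNextRound.exists_fixedPrime_package_of_stratum`)

DATA: the invariant — base `(A, P, φ, 𝔭)` log regular at `𝔭` and along the stratum of `𝔭`, `P` fs spanning,
`n − rk F_𝔭 ≤ 2`; cone chart algebra `(C, Q, χ)` of measure `d` ((χ), (gen), (D), (K), (Ω), `Q.FG`, cone in normal form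
`ℤF_𝔭 + {m u + l e : l ≥ 0, a l ≤ d m}`, `a < d`). RESULT **`stalk_regular_or_fixedPrime_of_stratum`**: for the chain `s`
of `round_charts` and `J = (χ(s))`, every point `p'` of `affineBlowup J` lying over `𝔭` has a regular local ring, or
`p' = awayι_h(q)` for some `h ∈ s` whose chart has vertex parameter `2 ≤ c ≤ d − 2`, with `q` corresponding to a prime
of `C_h` over `𝔭` containing `χ_h(Q_h ∖ ℤF_𝔭)` which is SINGULAR. Since the hypotheses hold at every point of the
stratum (same unit face), this describes the singular locus of the blown-up chart over the whole stratum.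

Honest label: assembly toward ONE leaf stub (no stub, crux or summit closed). No definitions, no named facts, no
sorry. [cite: Kato1994, (7.3), (10.1), (10.3)] [cite: GortzWedhorn2020, (13.19) p. 415]
-/

noncomputable section

-- single-problem summit: the doubled namespace component is forced
set_option linter.dupNamespace false

open CategoryTheory AlgebraicGeometry TopologicalSpace
open IsLocalRing Literature.AlgebraicGeometry.Resolution Literature.AlgebraicGeometry.Resolution.LogChart
open Summit.ResolutionOfSingularities.ResolutionOfSingularities.Theorems.FRationalResolution.ConeChainCharts
open Summit.ResolutionOfSingularities.ResolutionOfSingularities.Theorems.FRationalResolution.ConeChartNextRound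
open Summit.ResolutionOfSingularities.ResolutionOfSingularities.Theorems.FRationalResolution.BlowupChartPoints
open Summit.ResolutionOfSingularities.ResolutionOfSingularities.Theorems.FRationalResolution.FixedStratumNextRound

namespace Summit.ResolutionOfSingularities.ResolutionOfSingularities.Theorems.FRationalResolution.FixedStratumBlowupPoints

universe u

set_option maxHeartbeats 400000 in
/-- **Over a point `𝔭` of a log stratum of ANY dimension, the points of `Bl_{(χ s)}(Spec C)` are regular or images of
fixed primes with `c ≥ 2`** (`…ConeChartBlowupPoints.stalk_regular_or_fixedPrime` with `h0`/`hdimA` replaced by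
`hreg'`/`hrank`). [cite: Kato1994, (7.3), (10.1), (10.3)] [cite: GortzWedhorn2020, (13.19) p. 415] -/
theorem stalk_regular_or_fixedPrime_of_stratum {A : Type} [CommRing A] [IsNoetherianRing A] {n : ℕ}
    {P : AddSubmonoid (Fin n → ℤ)} {φ : Multiplicative P →* A} {𝔭 : Ideal A} [𝔭.IsPrime]
    {C : Type} [CommRing C] [Algebra A C] [IsNoetherianRing C] {Q : AddSubmonoid (Fin n → ℤ)}
    {χ : Multiplicative Q →* C} {u e : Fin n → ℤ} {a d : ℕ} (had : a < d) (hP : P.FG)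
    (hsat : ∀ (w : Fin n → ℤ) (k : ℕ), 0 < k → k • w ∈ P → w ∈ P)
    (hspanP : Submodule.span ℤ (P : Set (Fin n → ℤ)) = ⊤) (hreg : IsLogRegularAt P φ 𝔭) (hPQ : P ≤ Q)
    (hχ : ∀ p : P, χ (Multiplicative.ofAdd ⟨(p : Fin n → ℤ), hPQ p.2⟩) =
      algebraMap A C (φ (Multiplicative.ofAdd p)))
    (hgen : Algebra.adjoin A (Set.range χ) = ⊤)
    (hD : ∀ q ∈ Q, ∃ p ∈ P, q + p ∈ P)
    (hK : ∀ a : A, algebraMap A C a = 0 → ∃ p : P, φ (Multiplicative.ofAdd p) * a = 0)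
    (hΩ : ∀ (K : Type) [Field K] (g : A →+* K), (∀ p : P, g (φ (Multiplicative.ofAdd p)) ≠ 0) →
      ∃ ω : C →+* K, ω.comp (algebraMap A C) = g)
    (hQfg : Q.FG)
    (hQ : ∀ w, w ∈ Q ↔ ∃ g ∈ Submodule.span ℤ (faceMonoid P φ 𝔭 : Set (Fin n → ℤ)), ∃ m l : ℤ,
      0 ≤ l ∧ (a : ℤ) * l ≤ (d : ℤ) * m ∧ w = g + m • u + l • e)
    (hind : ∀ g ∈ Submodule.span ℤ (faceMonoid P φ 𝔭 : Set (Fin n → ℤ)), ∀ m l : ℤ,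
      g + m • u + l • e = 0 → m = 0 ∧ l = 0)
    (hspan : ∀ w : Fin n → ℤ, ∃ g ∈ Submodule.span ℤ (faceMonoid P φ 𝔭 : Set (Fin n → ℤ)),
      ∃ m l : ℤ, w = g + m • u + l • e)
    (hreg' : ∀ (𝔮 : Ideal A) [𝔮.IsPrime], 𝔮 ≤ 𝔭 → ideal P φ 𝔭 ≤ 𝔮 → IsLogRegularAt P φ 𝔮)
    (hrank : n - Module.finrank ℤ (Submodule.span ℤ (faceMonoid P φ 𝔭 : Set (Fin n → ℤ))) ≤ 2) :
    ∃ s : Set (Fin n → ℤ), s.Finite ∧ s ⊆ Q ∧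
      (∀ h ∈ s, h ∉ Submodule.span ℤ (faceMonoid P φ 𝔭 : Set (Fin n → ℤ))) ∧
      (∀ q ∈ Q, q ∉ Submodule.span ℤ (faceMonoid P φ 𝔭 : Set (Fin n → ℤ)) → ∃ h ∈ s, q - h ∈ Q) ∧
      ∀ p' : affineBlowup (Ideal.span ((fun q : Q => χ (Multiplicative.ofAdd q)) '' {q : Q | (q : Fin n → ℤ) ∈ s})),
        ((affineBlowup.π _ p').asIdeal.comap (algebraMap A C) = 𝔭) →
        IsRegularLocalRing ((affineBlowup (Ideal.span ((fun q : Q => χ (Multiplicative.ofAdd q)) ''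
          {q : Q | (q : Fin n → ℤ) ∈ s}))).presheaf.stalk p') ∨
        ∃ (h : Fin n → ℤ) (hhQ : h ∈ Q) (hhs : h ∈ s) (v x : Fin n → ℤ) (c : ℕ), 2 ≤ c ∧ c + 2 ≤ d ∧
          (∀ w, w ∈ blowupChartMonoid Q {q : Q | (q : Fin n → ℤ) ∈ s} ⟨h, hhQ⟩ ↔
            ∃ g ∈ Submodule.span ℤ (faceMonoid P φ 𝔭 : Set (Fin n → ℤ)), ∃ m l : ℤ,
              0 ≤ m ∧ 0 ≤ m + (c : ℤ) * l ∧ w = g + m • v + l • x) ∧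
          (∀ g ∈ Submodule.span ℤ (faceMonoid P φ 𝔭 : Set (Fin n → ℤ)), ∀ m l : ℤ,
            g + m • v + l • x = 0 → m = 0 ∧ l = 0) ∧
          (∀ w : Fin n → ℤ, ∃ g ∈ Submodule.span ℤ (faceMonoid P φ 𝔭 : Set (Fin n → ℤ)),
            ∃ m l : ℤ, w = g + m • v + l • x) ∧
          ∃ (q : Spec (.of (HomogeneousLocalization.Away (reesGrading (Ideal.span ((fun q : Q => χ (Multiplicative.ofAdd q)) '' {q : Q | (q : Fin n → ℤ) ∈ s}))) (reesT (χ (Multiplicative.ofAdd ⟨h, hhQ⟩)) (Ideal.subset_span (Set.mem_image_of_mem (fun q : Q => χ (Multiplicative.ofAdd q)) (show (⟨h, hhQ⟩ : Q) ∈ {q : Q | (q : Fin n → ℤ) ∈ s} from hhs)))))))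
            (𝔔 : Ideal (blowupAlgebra (Ideal.span ((fun q : Q => χ (Multiplicative.ofAdd q)) '' {q : Q | (q : Fin n → ℤ) ∈ s})) (χ (Multiplicative.ofAdd ⟨h, hhQ⟩)))) (_ : 𝔔.IsPrime),
            Proj.awayι (reesGrading (Ideal.span ((fun q : Q => χ (Multiplicative.ofAdd q)) '' {q : Q | (q : Fin n → ℤ) ∈ s}))) (reesT (χ (Multiplicative.ofAdd ⟨h, hhQ⟩)) (Ideal.subset_span (Set.mem_image_of_mem (fun q : Q => χ (Multiplicative.ofAdd q)) (show (⟨h, hhQ⟩ : Q) ∈ {q : Q | (q : Fin n → ℤ) ∈ s} from hhs)))) (reesT_mem (χ (Multiplicative.ofAdd ⟨h, hhQ⟩)) (Ideal.subset_span (Set.mem_image_of_mem (fun q : Q => χ (Multiplicative.ofAdd q)) (show (⟨h, hhQ⟩ : Q) ∈ {q : Q | (q : Fin n → ℤ) ∈ s} from hhs)))) one_pos q = p' ∧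
            (∀ t, t ∈ q.asIdeal ↔ reesChartEquiv (I := (Ideal.span ((fun q : Q => χ (Multiplicative.ofAdd q)) '' {q : Q | (q : Fin n → ℤ) ∈ s}))) (χ (Multiplicative.ofAdd ⟨h, hhQ⟩)) (Ideal.subset_span (Set.mem_image_of_mem (fun q : Q => χ (Multiplicative.ofAdd q)) (show (⟨h, hhQ⟩ : Q) ∈ {q : Q | (q : Fin n → ℤ) ∈ s} from hhs))) t ∈ 𝔔) ∧
            𝔔.comap (algebraMap A _) = 𝔭 ∧
            (∀ qq : blowupChartMonoid Q {q : Q | (q : Fin n → ℤ) ∈ s} ⟨h, hhQ⟩,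
              (qq : Fin n → ℤ) ∉ Submodule.span ℤ (faceMonoid P φ 𝔭 : Set (Fin n → ℤ)) →
                blowupChart Q χ {q : Q | (q : Fin n → ℤ) ∈ s} ⟨h, hhQ⟩ (Multiplicative.ofAdd qq) ∈ 𝔔) ∧
            ¬ IsRegularLocalRing (Localization.AtPrime 𝔔) := by
  classical
  obtain ⟨s, hsfin, hsQ, hsL, hsgen, hchart⟩ := round_charts had hQ hind
  refine ⟨s, hsfin, hsQ, hsL, hsgen, fun p' hp' => ?_⟩
  -- the generating family of `J = (χ s)` indexed by `S`
  let xg : {q : Q | (q : Fin n → ℤ) ∈ s} → C := fun q => χ (Multiplicative.ofAdd (q : Q))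
  have hxJ : ∀ i : {q : Q | (q : Fin n → ℤ) ∈ s}, xg i ∈ (Ideal.span ((fun q : Q => χ (Multiplicative.ofAdd q)) '' {q : Q | (q : Fin n → ℤ) ∈ s})) :=
    fun i => Ideal.subset_span ⟨i.1, i.2, rfl⟩
  have hJle : (Ideal.span ((fun q : Q => χ (Multiplicative.ofAdd q)) '' {q : Q | (q : Fin n → ℤ) ∈ s})) ≤ Ideal.span (Set.range xg) := by
    refine Ideal.span_le.2 ?_
    rintro _ ⟨q, hq, rfl⟩
    exact Ideal.subset_span ⟨⟨q, hq⟩, rfl⟩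
  obtain ⟨⟨⟨h, hhQ⟩, hhs⟩, q, 𝔔, h𝔔, hpq, hmemq, hcomap, hregiff⟩ :=
    exists_chart_point_prime (Ideal.span ((fun q : Q => χ (Multiplicative.ofAdd q)) '' {q : Q | (q : Fin n → ℤ) ∈ s})) xg hxJ hJle p'
  -- `𝔔` lies over `𝔭`
  have h𝔔A : 𝔔.comap (algebraMap A _) = 𝔭 := by
    rw [IsScalarTower.algebraMap_eq A C, ← Ideal.comap_comap, hcomap]; exact hp'
  -- the vertex data of the chart at `h`
  have hhs' : (h : Fin n → ℤ) ∈ s := hhs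
  obtain ⟨v, x, c, hcd, hindvx, hspanvx, hQh⟩ := hchart h hhQ hhs'
  have hspanvx' : ∀ w : Fin n → ℤ, ∃ g ∈ Submodule.span ℤ (faceMonoid P φ 𝔭 : Set (Fin n → ℤ)),
      ∃ m l : ℤ, w = g + m • v + l • x := fun w => hspanvx w (hspan w)
  rcases Nat.lt_or_ge c 2 with hc | hc
  · -- `c ≤ 1`: every prime over `𝔭` is regular
    left
    rw [hregiff]
    exact isRegularLocalRing_chart_of_param_le_one (by omega) hP hsat hspanP hPQ hχ hgen hD hK hΩ hreg hhQ hQh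
      hindvx hspanvx' 𝔔 h𝔔A
  · -- `c ≥ 2`: regular unless `𝔔` is the fixed prime
    obtain ⟨𝔓h, h𝔓hprime, h𝔓hA, h𝔓hq, -, hsing, hregother, -⟩ := exists_fixedPrime_package_of_stratum hc hsfin hP
      hsat hspanP hreg hreg' hrank hPQ hχ hgen hD hK hΩ hQfg hhQ hQh hindvx hspanvx'
    by_cases hne : 𝔔 = 𝔓h
    · right
      subst hne
      refine ⟨h, hhQ, hhs', v, x, c, hc, ?_, hQh, hindvx, hspanvx', q, 𝔔, h𝔔, hpq, hmemq, h𝔔A,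
        fun qq hqq => (h𝔓hq qq).2 hqq, hsing⟩
      rcases hcd with hcd | hcd
      · omega
      · exact hcd
    · left
      rw [hregiff]
      exact hregother 𝔔 h𝔔A hne

end Summit.ResolutionOfSingularities.ResolutionOfSingularities.Theorems.FRationalResolution.FixedStratumBlowupPoints

end
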